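import Literature.Computability.QuantumComplexity.CompilerWordBounds
import Literature.Computability.QuantumComplexity.EncodedCompilation
import Literature.Computability.QuantumComplexity.HidingProgramMachine
import HarnessLib

/-!
# The polynomial budget of the braid compiler and the compiled words as typed `FP` maps

Topic `Literature/Computability/QuantumComplexity`, sequel of `CompilerWordBounds.lean` and
`EncodedCompilation.lean` (Aharonov–Arad 2011, Thm. 3.1, §3.3: the classical pre-compilation is
polynomial). For `m` primitive operations the reduction uses `L = lOf m` descent levels and
`S = sOf L` tower levels; the cap `capBound` of the capped compiler is bounded by the polynomial
`capOf K m = (2m + K)^20` for any `K` above an explicit constant (`capBound_le_capOf`; the size bound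
`two_pow_size_le'` is the tree's, `HidingProgramMachine.lean`), so that the
word compiled for a fixed net, seed and score is a typed polynomial-time function of `1ᵐ`
(**`wordOf_codeFP`**), computed as: budget `(2m + K)^20` units, `L`, `S`, `2^S`, `Jmax = 50^{2^S} + 2`
in unary within the budget, the scales `(1, 200·4^t)_{t<L}`, then `compileCap` (= `compile`,
`compileCap_eq_compile`).

## References

* D. Aharonov, I. Arad, New J. Phys. 13 (2011) 035019, §3.3 [AharonovArad2011].
* S. Arora, B. Barak, *Computational Complexity*, CUP 2009, §1.2–1.3 [AroraBarak2009].
-/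

namespace Literature.Computability.QuantumComplexity

open Literature.Computability.Complexity Literature.Computability.Complexity.CodeFP ExactCompiler

/-! ### Elementary size bounds -/

/-- `2 ^ size n ≤ 2 n + 1` (local helper). [folklore] -/
private theorem two_pow_size_le (n : ℕ) : 2 ^ Nat.size n ≤ 2 * n + 1 := by
  rcases Nat.eq_zero_or_pos n with rfl | hn
  · simp
  · have h : Nat.size n - 1 < Nat.size n := Nat.sub_lt (Nat.size_pos.2 hn) Nat.one_pos
    have h2 := Nat.lt_size.1 h
    have e : Nat.size n = Nat.size n - 1 + 1 := by omega
    rw [e, pow_succ]; omega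

/-- `size n ≤ n` (local helper). [folklore] -/
private theorem size_le_self (n : ℕ) : Nat.size n ≤ n := Nat.size_le.2 (Nat.lt_two_pow_self)

/-! ### The polynomial budget -/

/-- **The cap of the reduction**: `(2m + K)^20`. [cite: AharonovArad2011, §3.3] -/
def capOf (K m : ℕ) : ℕ := (2 * m + K) ^ 20

/-- The smallest admissible `K`. [folklore] -/
def kMin (mat₀ : Letter → Matrix (Fin 2) (Fin 2) K5) (v w₀ : ℕ) : ℕ := 52 + (w₀ + 2 * v) + candA mat₀ + candB + 2 ^ 48

/-- Powers of the base dominate. [folklore] -/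
theorem le_pow_of_le {B k : ℕ} (hB : 1 ≤ B) (hk : 1 ≤ k) : B ≤ B ^ k := by
  calc B = B ^ 1 := (pow_one B).symm
    _ ≤ B ^ k := Nat.pow_le_pow_right hB hk

/-- `2^S ≤ 2m + K` for `K ≥ 9`. [folklore] -/
theorem two_pow_sOf_le {K : ℕ} (hK : 9 ≤ K) (m : ℕ) : 2 ^ sOf (lOf m) ≤ 2 * m + K := by
  show 2 ^ Nat.size (Nat.size m + 4) ≤ 2 * m + K
  have h1 := two_pow_size_le (Nat.size m + 4); have h2 := size_le_self m
  omega

/-- `2^L ≤ 2m + K` for `K ≥ 1`. [folklore] -/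
theorem two_pow_lOf_le {K : ℕ} (hK : 1 ≤ K) (m : ℕ) : 2 ^ lOf m ≤ 2 * m + K := by
  show 2 ^ Nat.size m ≤ 2 * m + K
  have := two_pow_size_le m; omega

/-- **`Jmax + 1 ≤ 2 (2m + K)^13`** for `K ≥ 2^48`. [folklore] -/
theorem jmax_le {K : ℕ} (hK : 2 ^ 48 ≤ K) (m : ℕ) : 50 ^ (2 ^ sOf (lOf m)) + 3 ≤ 2 * (2 * m + K) ^ 13 := by
  set B := 2 * m + K with hB
  set L := lOf m with hL
  have hK1 : 1 ≤ K := le_trans Nat.one_le_two_pow hK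
  have h2L : 2 ^ L ≤ B := two_pow_lOf_le hK1 m
  have h1 : 50 ^ (2 ^ sOf L) ≤ 50 ^ (2 * (L + 4)) := Nat.pow_le_pow_right (by norm_num) (two_pow_size_le' (x := L + 4) (by omega))
  have h2 : 50 ^ (2 * (L + 4)) = 2500 ^ L * 2500 ^ 4 := by rw [pow_mul, show (50:ℕ)^2 = 2500 by norm_num, pow_add]
  have h3 : 2500 ^ L ≤ B ^ 12 := by
    calc 2500 ^ L ≤ (2 ^ 12) ^ L := Nat.pow_le_pow_left (by norm_num) L
      _ = (2 ^ L) ^ 12 := by rw [← pow_mul, ← pow_mul, mul_comm]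
      _ ≤ B ^ 12 := Nat.pow_le_pow_left h2L 12
  have h44 : (2500 : ℕ) ^ 4 ≤ 2 ^ 48 := by norm_num
  have h4 : 2500 ^ 4 ≤ B := by omega
  have h5 : 3 ≤ B ^ 13 := le_trans (by omega) (le_pow_of_le (by omega) (by norm_num))
  calc 50 ^ (2 ^ sOf L) + 3 ≤ 2500 ^ L * 2500 ^ 4 + 3 := by rw [← h2]; omega
    _ ≤ B ^ 12 * B + 3 := by gcongr
    _ = B ^ 13 + 3 := by rw [← pow_succ]
    _ ≤ 2 * B ^ 13 := by omega

/-- **The cap bound is polynomial**: `capBound ≤ (2m + K)^20` for `K ≥ kMin`. [cite: AharonovArad2011, §3.3] -/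
theorem capBound_le_capOf (mat₀ : Letter → Matrix (Fin 2) (Fin 2) K5) (v w₀ : ℕ) {K : ℕ} (hK : kMin mat₀ v w₀ ≤ K) (m : ℕ) :
    capBound mat₀ v w₀ (sOf (lOf m)) (50 ^ (2 ^ sOf (lOf m)) + 2) (lOf m) ≤ capOf K m := by
  unfold kMin at hK
  set B := 2 * m + K with hB
  set L := lOf m with hL
  set S := sOf L with hS
  have hB1 : 52 ≤ B := by omega
  have hLm : L ≤ m := size_le_self m
  have h2S : 2 ^ S ≤ B := two_pow_sOf_le (K := K) (by omega) m
  have hSB : S ≤ B := by have : Nat.size (L + 4) ≤ L + 4 := size_le_self (L + 4); rw [hS, sOf]; omega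
  have h4S : 4 ^ S ≤ B ^ 2 := by
    rw [show (4 : ℕ) = 2 ^ 2 by norm_num, ← pow_mul, mul_comm, pow_mul]; exact Nat.pow_le_pow_left h2S 2
  have hJ : 50 ^ (2 ^ S) + 3 ≤ 2 * B ^ 13 := jmax_le (K := K) (by omega) m
  have hw : w₀ + 2 * v ≤ B := by omega
  have hX : 4 ^ S * (w₀ + 2 * v) ≤ B ^ 3 := by
    calc 4 ^ S * (w₀ + 2 * v) ≤ B ^ 2 * B := Nat.mul_le_mul h4S hw
      _ = B ^ 3 := by rw [← pow_succ]
  have hY : 2 * v + (50 ^ (2 ^ S) + 2 + 1) * (4 ^ S * (w₀ + 2 * v)) ≤ 3 * B ^ 16 := by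
    have h1 : (50 ^ (2 ^ S) + 2 + 1) * (4 ^ S * (w₀ + 2 * v)) ≤ 2 * B ^ 13 * B ^ 3 := Nat.mul_le_mul hJ hX
    have h2 : 2 * B ^ 13 * B ^ 3 = 2 * B ^ 16 := by rw [mul_assoc, ← pow_add]
    have h3 : 2 * v ≤ B ^ 16 := le_trans (by omega) (le_pow_of_le (by omega) (by norm_num))
    omega
  have hWB : wordBound v w₀ S (50 ^ (2 ^ S) + 2) L ≤ 3 * B ^ 17 := by
    rw [wordBound]
    calc (L + 2) * (2 * v + (50 ^ (2 ^ S) + 2 + 1) * (4 ^ S * (w₀ + 2 * v))) ≤ B * (3 * B ^ 16) := Nat.mul_le_mul (by omega) hY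
      _ = 3 * B ^ 17 := by rw [pow_succ]; ring
  have hA : candA mat₀ ≤ B := by omega
  have hBc : candB ≤ B := by omega
  have hin : candA mat₀ * wordBound v w₀ S (50 ^ (2 ^ S) + 2) L + candB ≤ 4 * B ^ 18 := by
    have h1 : candA mat₀ * wordBound v w₀ S (50 ^ (2 ^ S) + 2) L ≤ B * (3 * B ^ 17) := Nat.mul_le_mul hA hWB
    have h2 : B * (3 * B ^ 17) = 3 * B ^ 18 := by rw [pow_succ]; ring
    have h3 : candB ≤ B ^ 18 := hBc.trans (le_pow_of_le (by omega) (by norm_num))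
    omega
  rw [capBound, capOf, ← hB]
  have h1 : (4 * S + 6) * (candA mat₀ * wordBound v w₀ S (50 ^ (2 ^ S) + 2) L + candB) ≤ (10 * B) * (4 * B ^ 18) := Nat.mul_le_mul (by omega) hin
  have h2 : (10 * B) * (4 * B ^ 18) = 40 * B ^ 19 := by rw [pow_succ]; ring
  have h3 : 4 * S + 8 ≤ 12 * B ^ 19 := le_trans (by omega) (Nat.mul_le_mul_left 12 (le_pow_of_le (by omega) (by norm_num)))
  have h4 : 52 * B ^ 19 ≤ B ^ 20 := by rw [pow_succ, mul_comm]; exact Nat.mul_le_mul_left _ hB1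
  omega

/-! ### The compiled word as a typed polynomial-time function of `1ᵐ` -/

/-- **The word compiled for `m` primitives** (fixed net, seed, score). [cite: AharonovArad2011, §3.3] -/
noncomputable def wordOf (sc : Matrix (Fin 2) (Fin 2) K5 → ZPhiS) (net : List (Cand Letter)) (c₀ : Cand Letter) (m : ℕ) : List Letter :=
  (compile net c₀ (sOf (lOf m)) sc (schedule (lOf m) (sOf (lOf m)))).word

/-- The input of the capped compiler as a typed function of `1ᵐ`: budget `(2m+K)^20`, `S`, `Jmax` and
the scales (truncations by the budget are vacuous, see `wordOf_codeFP`). [folklore] -/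
theorem compileArgs_codeFP (K : ℕ) (net : List (Cand Letter)) (c₀ : Cand Letter) :
    CodeFP unE (pairE (pairE (pairE unE (rawE candE)) (pairE candE unE)) (pairE (rawE unitE) (rawE (pairE natE natE))))
      (fun m => (((capOf K m, net), (c₀, sOf (lOf m))),
        (List.replicate (min (50 ^ (min (2 ^ sOf (lOf m)) (capOf K m)) + 2) (List.replicate (capOf K m) ()).length) (),
         (List.range (lOf m)).map fun t => ((1 : ℕ), 200 * 4 ^ (min t (capOf K m)))))) := by
  -- the budget `(2m + K)^20` in units and the cap in unary
  have hBu : CodeFP unE unE (fun m => 2 * m + K) := (unAdd.comp ((unAdd.comp ((CodeFP.id _).pair (CodeFP.id _))).pair (const _ K))).congr fun m => by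
    show m + m + K = 2 * m + K; ring
  have hcapU : CodeFP unE (rawE unitE) (fun m => List.replicate (capOf K m) ()) := ((unitsPow 20).comp hBu).congr fun _ => rfl
  have hcap : CodeFP unE unE (fun m => capOf K m) := ((ulength unitE).comp hcapU).congr fun _ => by simp
  -- `L`, `S`, `2^S`, `Jmax`
  have hL : CodeFP unE unE (fun m => lOf m) := (natSizeU_codeFP.comp natOfUn).congr fun _ => rfl
  have hL4 : CodeFP unE unE (fun m => lOf m + 4) := unAdd.comp (hL.pair (const _ 4))
  have hS : CodeFP unE unE (fun m => sOf (lOf m)) := (natSizeU_codeFP.comp (natOfUn.comp hL4)).congr fun _ => rfl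
  have h2Sargs : CodeFP unE (pairE natE unE) (fun m => ((2 : ℕ), sOf (lOf m))) := (const _ 2).pair hS
  have h2S : CodeFP unE natE (fun m => 2 ^ sOf (lOf m)) := (natPow.comp h2Sargs).congr fun _ => rfl
  have h2Suargs : CodeFP unE (pairE unE natE) (fun m => (capOf K m, 2 ^ sOf (lOf m))) := hcap.pair h2S
  have h2Su : CodeFP unE unE (fun m => min (2 ^ sOf (lOf m)) (capOf K m)) := (unOfNatMin.comp h2Suargs).congr fun _ => rfl
  have hJargs : CodeFP unE (pairE natE unE) (fun m => ((50 : ℕ), min (2 ^ sOf (lOf m)) (capOf K m))) := (const _ 50).pair h2Su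
  have hJ0 : CodeFP unE natE (fun m => 50 ^ (min (2 ^ sOf (lOf m)) (capOf K m))) := (natPow.comp hJargs).congr fun _ => rfl
  have hJnargs : CodeFP unE (pairE natE natE) (fun m => (50 ^ (min (2 ^ sOf (lOf m)) (capOf K m)), (2 : ℕ))) := hJ0.pair (const _ 2)
  have hJn : CodeFP unE natE (fun m => 50 ^ (min (2 ^ sOf (lOf m)) (capOf K m)) + 2) := (natAdd.comp hJnargs).congr fun _ => rfl
  have hJuargs : CodeFP unE (pairE (rawE unitE) natE) (fun m => (List.replicate (capOf K m) (), 50 ^ (min (2 ^ sOf (lOf m)) (capOf K m)) + 2)) := hcapU.pair hJn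
  have hJu : CodeFP unE (rawE unitE) (fun m => List.replicate (min (50 ^ (min (2 ^ sOf (lOf m)) (capOf K m)) + 2) (List.replicate (capOf K m) ()).length) ()) :=
    (unitsOfNatMin.comp hJuargs).congr fun _ => rfl
  -- the scales `(1, 200 · 4^t)`, `t < L`
  have htargs : CodeFP (pairE unE natE) (pairE natE unE) (fun q => ((4 : ℕ), min q.2 q.1)) := (const _ 4).pair unOfNatMin
  have h4t : CodeFP (pairE unE natE) natE (fun q => 4 ^ (min q.2 q.1)) := (natPow.comp htargs).congr fun _ => rfl
  have hmargs : CodeFP (pairE unE natE) (pairE natE natE) (fun q => ((200 : ℕ), 4 ^ (min q.2 q.1))) := (const _ 200).pair h4t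
  have hm : CodeFP (pairE unE natE) natE (fun q => 200 * 4 ^ (min q.2 q.1)) := (natMul.comp hmargs).congr fun _ => rfl
  have hpq : CodeFP (pairE unE natE) (pairE natE natE) (fun q => ((1 : ℕ), 200 * 4 ^ (min q.2 q.1))) := (const _ 1).pair hm
  have hpqsargs : CodeFP unE (pairE unE (rawE natE)) (fun m => (capOf K m, List.range (lOf m))) := hcap.pair (urange.comp hL)
  have hpqs : CodeFP unE (rawE (pairE natE natE)) (fun m => (List.range (lOf m)).map fun t => ((1 : ℕ), 200 * 4 ^ (min t (capOf K m)))) :=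
    ((CodeFP.map hpq).comp hpqsargs).congr fun _ => rfl
  exact ((hcap.pair (const _ net)).pair ((const _ c₀).pair hS)).pair (hJu.pair hpqs)

variable (E : EvalSpec Letter)

/-- **The compiled word is a typed polynomial-time function of `1ᵐ`**, for a well-formed net and
seed and a typed score. [cite: AharonovArad2011, §3.3] -/
theorem wordOf_codeFP {sc : Matrix (Fin 2) (Fin 2) K5 → ZPhiS} (hsc : CodeFP matE zphisE sc) {net : List (Cand Letter)} (hnet : AllWF E net)
    {c₀ : Cand Letter} (hc₀ : c₀.WF E.mat₀) : CodeFP unE (rawE letterE) (wordOf sc net c₀) := by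
  set K := kMin E.mat₀ (maxWlen net) (wlen c₀) with hK
  have hcomp := (compileCap_codeFP hsc).comp (compileArgs_codeFP K net c₀)
  refine ((candWord hcomp).congr fun m => ?_)
  -- the caps are not reached and the truncations are vacuous
  have hKle : kMin E.mat₀ (maxWlen net) (wlen c₀) ≤ K := le_rfl
  have hcapBig := capBound_le_capOf E.mat₀ (maxWlen net) (wlen c₀) hKle m
  have hK52 : 52 ≤ K := by rw [hK]; unfold kMin; omega
  have hK48 : 2 ^ 48 ≤ K := by rw [hK]; unfold kMin; omega
  have hB52 : 52 ≤ 2 * m + K := by omega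
  have hBle : 2 * m + K ≤ capOf K m := le_pow_of_le (by omega) (by norm_num)
  have h2Sle : 2 ^ sOf (lOf m) ≤ capOf K m := (two_pow_sOf_le (K := K) (by omega) m).trans hBle
  have hJle : 50 ^ (2 ^ sOf (lOf m)) + 2 ≤ capOf K m := by
    have h1 := jmax_le hK48 m
    have h2 : 2 * (2 * m + K) ^ 13 ≤ capOf K m := by
      rw [capOf]
      calc 2 * (2 * m + K) ^ 13 ≤ (2 * m + K) * (2 * m + K) ^ 13 := Nat.mul_le_mul_right _ (by omega)
        _ = (2 * m + K) ^ 14 := by ring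
        _ ≤ (2 * m + K) ^ 20 := Nat.pow_le_pow_right (by omega) (by norm_num)
    omega
  have hLle : lOf m ≤ capOf K m := (size_le_self m).trans (by have := hBle; omega)
  rw [Nat.min_eq_left h2Sle, List.length_replicate, Nat.min_eq_left hJle]
  have hsched : ((List.range (lOf m)).map fun t => ((1 : ℕ), 200 * 4 ^ (min t (capOf K m)))) =
      (List.range (lOf m)).map fun t => ((1 : ℕ), 200 * 4 ^ t) := by
    refine List.map_congr_left fun t ht => ?_
    rw [List.mem_range] at ht
    rw [Nat.min_eq_left (by omega)]
  rw [hsched, compileCap_eq_compile E hnet hc₀ le_rfl le_rfl sc (sOf (lOf m)) (50 ^ (2 ^ sOf (lOf m)) + 2) (lOf m) hcapBig]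
  rfl

end Literature.Computability.QuantumComplexity
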